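import Summits.BirchSwinnertonDyer.BirchSwinnertonDyer.Theorems.CMKolyvaginAtInertTwoShaCountCompositeAtTwo
import HarnessLib

/-!
# Route `CMKolyvaginAtInertTwo`, crux `CMKolyvaginExactAtInertTwo` (stmt-BirchSwinnertonDyer-24277):
# THE COUNT IDENTITY, XVII — REDUCTION of the crux's conclusion to the PAIR over `ℚ` for EVERY odd
# `d_K` (no primality): `n_E · #Ш(E)[2^∞] · #Ш(E^{(d_K)})[2^∞] · 2^{Σ_q} = 2^{2M₀+1} ⟹ #Ш(E_K)[2^∞] = 2^{2M₀}`

Seat `bsd-line-cmk2-p1` g15 (cell `bsd-print-cf2`); helper (`--supports stmt-BirchSwinnertonDyer-24277`).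
THEOREMS ONLY: no definition, no named fact, no `sorry`; the route's published inputs (Gross–Zagier
all levels, GZK, modularity, Milne any-model) are HYPOTHESES; no item is closed; BSD is not proved
by this.

File IX reduced the conclusion `Nat.card (Ш(E_K)(2)) = 2^{2M₀}` of 24277 to the pair count
`#Ш(E)[2^∞]·#Ш(E^{(d_K)})[2^∞] = 2^{2M₀}` on PRIME `|d_K|` (whence the TURNKEY's restated 24277′). With
file XV's identity for every odd `d_K` the restatement is unnecessary: 24277 AS FILED follows from
the route's facts and the PAIR-WITH-DEFECT count
`n_E · #Ш(E)[2^∞] · #Ш(E^{(d_K)})[2^∞] · 2^{Σ_{q ∣ d_K}([(Δ/q) = −1] + 2[(Δ/q) = 1 ∧ a_q even])} = 2^{2M₀+1}`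
(`n_E = 2` if `Δ > 0`, else `1`; on H₂, `Δ < 0`, the defect sum is `≥ 1` by file XVI, and `= 1` when
`|d_K|` is prime). This file is that one-line reduction, for the TURNKEY (v2) to cite by name.

* `card_primaryComponent_sha_two_baseChange_eq_pow_of_pairDefect_of_facts`.
-/

-- single-conjunct summit: `Summit.BirchSwinnertonDyer.BirchSwinnertonDyer.…` repeats the name by design
set_option linter.dupNamespace false
set_option autoImplicit false

noncomputable section

open scoped Classical

open WeierstrassCurve NumberField Literature.NumberTheory.EllipticCurves
  Literature.NumberTheory.EllipticCurves.ModularForms Literature.NumberTheory.QuadraticFields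

namespace Summit.BirchSwinnertonDyer.BirchSwinnertonDyer.Theorems.ShaCountTwo

/-- **REDUCTION OF THE CRUX'S CONCLUSION TO THE PAIR OVER `ℚ`, EVERY ODD `d_K`** (modulo the route's
published inputs). Under the hypotheses of
`card_primaryComponent_sha_two_baseChange_mul_two_eq_of_heegnerData_of_facts` (`W` globally minimal
with `ρ̄_{E,2}` onto; `K` imaginary quadratic, `d_K` odd, Heegner hypothesis; Heegner datum with
`y_K = P(1)` of infinite order), if
`n_E · #Ш(E)[2^∞] · #Ш(E^{(d_K)})[2^∞] · 2^{Σ_{q ∣ d_K}([(Δ/q) = −1] + 2[(Δ/q) = 1 ∧ a_q even])} = 2^{2M₀+1}`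
then `#Ш(E_K)[2^∞] = 2^{2M₀}` — the conclusion of `CMKolyvaginExactAtInertTwo` in its own currency.
[cite: Milne1972ArithmeticAV, §1 Thm. 1] [cite: Kramer1981, Prop. 3] [cite: McCallumLMS1991, §5 Thm. 5.4, Cor. 5.6] -/
theorem card_primaryComponent_sha_two_baseChange_eq_pow_of_pairDefect_of_facts
    (hGZ : ∀ (N : ℕ) [NeZero N] (W : WeierstrassCurve ℚ) (K : Type) [Field K] [NumberField K],
      gross_zagier N W K)
    (hGZK : rank_eq_analyticRank_of_analyticRank_le_one) (hmod : hasEntireLFunction_rat)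
    (hMilneC : Milne1972.bsdQuotient_baseChange_quadratic_anyModel)
    (W : WeierstrassCurve ℚ) [W.IsElliptic] [W.IsGloballyMinimal] [NeZero (W.conductorNorm ℤ)]
    (hsurj : W.HasSurjectiveModNGaloisRep 2)
    (K : Type) [Field K] [NumberField K] (hK : IsImaginaryQuadratic K)
    (hodd : Odd (NumberField.discr K)) (hH : SatisfiesHeegnerHypothesis (W.conductorNorm ℤ) K)
    (Dt : ModularParametrizationData W (W.conductorNorm ℤ)) (β : ℤ) (ι : K →+* ℂ)
    (d₁ : KolyvaginHeegnerData Dt β ι 1) (hy : ¬ IsOfFinAddOrder d₁.derivedPoint) {M₀ : ℕ}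
    (hpair : (if 0 < W.Δ then 2 else 1) *
      (Nat.card (AddCommGroup.primaryComponent W.sha 2) *
        Nat.card (AddCommGroup.primaryComponent (W.quadraticTwist (NumberField.discr K : ℚ)).sha 2)) *
      2 ^ ∑ q ∈ (NumberField.discr K).natAbs.primeFactors,
        ((if jacobiSym W.Δ.num q = -1 then 1 else 0) +
          (if jacobiSym W.Δ.num q = 1 ∧ Even (W.frobeniusTrace q) then 2 else 0)) =
      2 ^ (2 * M₀ + 1)) :
    Nat.card (AddCommGroup.primaryComponent (W.baseChange K).sha 2) = 2 ^ (2 * M₀) := by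
  have h := (card_primaryComponent_sha_two_baseChange_mul_two_eq_of_heegnerData_of_facts hGZ hGZK hmod
    hMilneC W hsurj K hK hodd hH Dt β ι d₁ hy).2
  rw [hpair, pow_succ] at h
  exact Nat.eq_of_mul_eq_mul_right two_pos h

end Summit.BirchSwinnertonDyer.BirchSwinnertonDyer.Theorems.ShaCountTwo

end
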